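/-
Origin: expansion seat `prover-pub-hodgecm-mc-binder-1-g13-0`, handover #67 2026-08-20T13:44:28Z md5 f8e6683398e6 (NEW additive KERNEL leaf; imports #66; drops ⇒ {#68}) (`HOME/mc/pub-hodgecm-mc-binder-1-g13/stage52/HodgeCM/Model/Binders/Real34HarchPoly.lean`, md5 f8e6683398e6, 179 lines);
landed by the second packager p2 gen 8 (p2-g8) in gate run 52 as `HodgeCM/Model/Binders/Real34HarchPoly.lean` (verbatim).
-/
/-
Origin: speedrun cell pub-hodgecm, MODEL-CONSTRUCTION sub-cell, unit pub-hodgecm-mc-binder-1-g13 (BINDER PROVER, gen 13; row 17 `real34`: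
the polynomial identity `hpoly` of `Binders/Real34Harch.harch_of_insPoly` at the base letter), seat prover-pub-hodgecm-mc-binder-1-g13-0, 2026-08-20.
Target in PKG: HodgeCM/Model/Binders/Real34HarchPoly.lean (NEW additive leaf; imports binder-1 `Binders/Real34Harch`).
KERNEL ONLY: theorems; 0 records, nothing cited, 0 `def … : Prop`; MODEL-N ±0; E unchanged.  Nothing here is a claim of the manuscripts under adjudication.
-/
import Summits.HodgeConjecture.HodgeCM.Model.Binders.Real34Harch

/-!
# The `ι₁` determinant letter IS the wedge of the two line letters (index bookkeeping for `hpoly`)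

binder-2's printed vacuum inserts, at the place `v₁` under `ι₁`, the determinant `det z = z₀₀ z₁₁ − z₀₁ z₁₀` read through the variable
identification `jIAt` (`z_{aj} ↦ finProdFinEquiv (row_a, j)`, `row_a` = the `a`-th positive `V`-direction of the pin frame at `v₁` in
discharge-3's numbering `iotaFrameA`); carch-1's line letters are `√π · X (row′_a, v₁)` with `row′_a` the same directions in carch-1's numbering
`(blockPosEquiv V)⁻¹`; theta-3's relabelling `conjColPerm S` does nothing at `v₁` when the bit is not set there.  Hence
**`rename (atPlace v₁) (rename jIAt detZ) = a″ • rename (conjColPerm S) wedgePoly`** with `a″ = ± π⁻¹` (the sign = the parity of the two numberings):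
the hypothesis `hpoly` of `harch_of_insPoly` for the base letter.
-/

set_option autoImplicit false

noncomputable section

open scoped Matrix Classical

namespace HodgeCM.Model

open MvPolynomial (rename X C)
open NumberField NumberField.InfinitePlace
open Literature.NumberTheory.Automorphic Literature.NumberTheory.Automorphic.UnitaryGroup Literature.NumberTheory.Weil1964
open Literature.RepresentationTheory.KonnoKonno2007 Literature.RepresentationTheory.KonnoKonno2007.RealDualPair
open Literature.NumberTheory.GelbartRogawski1991 Literature.NumberTheory.GelbartRogawski1991.UnitaryDualPair
open Literature.RepresentationTheory (atPlace)
open Literature.Analysis.SegalBargmann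
open HodgeCM HodgeCM.Adelic HodgeCM.PerL34 HodgeCM.Model.HypCensus HodgeCM.Model.ArchSideTerm
open HodgeCM.PerL34.Fock

section Rows

variable {L : CMField} {ι₁ : L →+* ℂ} (V : HermSpace3 L ι₁) (S : StubTree.SeesawDatum L)
variable (hW : (∀ j, 0 < (ι₁ ((dW S) j)).re) ∨ ∀ j, (ι₁ ((dW S) j)).re < 0)

/-- binder-2's row of the printed variable `z_{a·}`: the `a`-th positive `V`-direction at `v₁` in discharge-3's numbering. -/
abbrev iotaRow (a : Fin 2) : Fin 3 :=
  ((iotaFrameA (L : Type) (frameD V) (frameD_real V) ι₁ (frameD_sign_ι₁ V) a : PosIdx (cmXV (L : Type) (frameD V) (frameD_real V) ι₁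
    (HypCensus.cmPlace (L : Type) ι₁))) : Fin 3)

/-- carch-1's row of the line letter `e_a^∨`: the same directions in carch-1's numbering `(blockPosEquiv V)⁻¹`. -/
abbrev lineRow (a : Fin 2) : Fin 3 :=
  (((blockPosEquiv V).symm a : PosIdx (cmXV (L : Type) (frameD V) (frameD_real V) ι₁ (HypCensus.cmPlace (L : Type) ι₁))) : Fin 3)

/-- the sign frame's inverse on a positive index is its underlying index. -/
theorem pinEpsV_symm_inl (v : {v : InfinitePlace (↥(maximalRealSubfield (L : Type))) // v.IsReal})
    (p : PosIdx (cmXV (L : Type) (frameD V) (frameD_real V) ι₁ v)) :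
    (cmEpsV (L : Type) (frameD V) (frameD_real V) ι₁ v).symm (Sum.inl p) = (p : Fin 3) := rfl

/-- (Ported verbatim from the HodgeCMPerL package; no docstring in the source.) -/
theorem pinEpsW_symm_inl (v : {v : InfinitePlace (↥(maximalRealSubfield (L : Type))) // v.IsReal})
    (r : PosIdx (cmXW (L : Type) (frameD V) (dW S) (dW_real S) ι₁ v)) :
    (cmEpsW (L : Type) (frameD V) (dW S) (dW_real S) ι₁ v).symm (Sum.inl r) = (r : Fin 2) := rfl

/-- (Ported verbatim from the HodgeCMPerL package; no docstring in the source.) -/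
theorem pinEpsW_symm_inr (v : {v : InfinitePlace (↥(maximalRealSubfield (L : Type))) // v.IsReal})
    (s : NegIdx (cmXW (L : Type) (frameD V) (dW S) (dW_real S) ι₁ v)) :
    (cmEpsW (L : Type) (frameD V) (dW S) (dW_real S) ι₁ v).symm (Sum.inr s) = (s : Fin 2) := rfl

/-- **binder-2's `ι₁` identification on the `z`-variables**: `jIAt z_{aj} = finProdFinEquiv (iotaRow a, j)` (both `W`-readings). -/
theorem jIAt_inl (a j : Fin 2) :
    jIAt (L : Type) (frameD V) (frameD_real V) (dW S) (dW_real S) ι₁ (frameD_sign_ι₁ V) hW (Sum.inl (a, j)) = finProdFinEquiv (iotaRow V a, j) := by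
  unfold jIAt
  split_ifs with hR
  · rw [Function.comp_apply, planeToDPIdx_z, pairFrame, Equiv.symm_trans_apply, Equiv.symm_trans_apply, Equiv.symm_symm, dpEquiv_symm_inl_inl,
      Equiv.prodCongr_symm, Equiv.prodCongr_apply, Prod.map]
    rfl
  · rw [Function.comp_apply, planeToDPIdxS_z, pairFrame, Equiv.symm_trans_apply, Equiv.symm_trans_apply, Equiv.symm_symm, dpEquiv_symm_inr_inl,
      Equiv.prodCongr_symm, Equiv.prodCongr_apply, Prod.map]
    rfl

/-- **the two numberings of the positive `V`-directions differ by a permutation of `Fin 2`**: `iotaRow a = lineRow (τ a)`,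
`τ = blockPosEquiv V ∘ iotaFrameA`. -/
theorem iotaRow_eq_lineRow (a : Fin 2) :
    iotaRow V a = lineRow V ((iotaFrameA (L : Type) (frameD V) (frameD_real V) ι₁ (frameD_sign_ι₁ V)).trans (blockPosEquiv V) a) := by
  simp only [iotaRow, lineRow, Equiv.trans_apply, Equiv.symm_apply_apply]

/-- the permutations of `Fin 2` are `1` and the swap. -/
theorem perm_fin_two_eq (τ : Equiv.Perm (Fin 2)) : τ = 1 ∨ τ = Equiv.swap 0 1 := by
  revert τ; decide

end Rows

section Poly

variable {L : CMField} {ι₁ : L →+* ℂ} (V : HermSpace3 L ι₁) (S : StubTree.SeesawDatum L)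
variable (hW : (∀ j, 0 < (ι₁ ((dW S) j)).re) ∨ ∀ j, (ι₁ ((dW S) j)).re < 0)
variable
  (hpos₂ : 0 < cmXW (L : Type) (frameD V) (lineVec (L : Type) (dW' S 0)) (fun _ => dW'_real S 0) ι₁ (HypCensus.cmPlace (L : Type) ι₁) 0)
  (hpos₃ : 0 < cmXW (L : Type) (frameD V) (lineVec (L : Type) (dW' S 1)) (fun _ => dW'_real S 1) ι₁ (HypCensus.cmPlace (L : Type) ι₁) 0)

/-- carch-1's degree-one polynomial at the coordinate covector `e_a`: the single Fock monomial `ζ_{(a,⋆)}`. -/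
theorem degOnePoly_single (S' : Type) [Fintype S'] (a : Fin 2) :
    degOnePoly S' (Pi.single a 1) = zeta (Finsupp.single (Sum.inl (Sum.inl (a, ())) : DPIdx (Fin 2) Unit Unit S') 1) := by
  rw [degOnePoly, Fintype.sum_prod_type, Fin.sum_univ_two]
  fin_cases a <;> simp

/-- (K9)'s column embedding in the plane's product index: column `0`. -/
theorem slotCol_inl (i : Fin 3) : (slotCol (Sum.inl i) : Fin (3 * 2)) = finProdFinEquiv (i, (0 : Fin 2)) := by
  rw [← finProdFinEquiv_symm_slotCol_inl, Equiv.apply_symm_apply]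

/-- … and column `1`. -/
theorem slotCol_inr (i : Fin 3) : (slotCol (Sum.inr i) : Fin (3 * 2)) = finProdFinEquiv (i, (1 : Fin 2)) := by
  rw [← finProdFinEquiv_symm_slotCol_inr, Equiv.apply_symm_apply]

/-- **carch-1's line letter polynomial is `√π · X (lineRow a)` at `v₁`** (and `1` elsewhere): `linePoly k a = √π • X (lineRow a, v₁)`. -/
theorem linePoly_eq (k : Fin 2)
    (hpos : 0 < cmXW (L : Type) (frameD V) (lineVec (L : Type) (dW' S k)) (fun _ => dW'_real S k) ι₁ (HypCensus.cmPlace (L : Type) ι₁) 0) (a : Fin 2) :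
    linePoly V S k hpos a = (((Real.sqrt Real.pi : ℝ) : ℂ)) • X (lineRow V a, HypCensus.cmPlace (L : Type) ι₁) := by
  rw [linePoly, prod_linePlacePoly, degOnePoly_single, rename_zeta_single, cmPlaceIdxAt_symm_inl_inl, pinEpsV_symm_inl, Equiv.prodUnique_apply,
    rename_zeta_single, zeta_single]

/-- **the wedge polynomial at `v₁`**: `wedgePoly = π • (X(r₀,0) X(r₁,1) − X(r₁,0) X(r₀,1))` with `r_a = lineRow a`, all variables at `v₁`. -/
theorem wedgePoly_eq :
    wedgePoly V S hpos₂ hpos₃ =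
      ((Real.pi : ℝ) : ℂ) •
        (X (finProdFinEquiv (lineRow V 0, (0 : Fin 2)), HypCensus.cmPlace (L : Type) ι₁) *
            X (finProdFinEquiv (lineRow V 1, (1 : Fin 2)), HypCensus.cmPlace (L : Type) ι₁) -
          X (finProdFinEquiv (lineRow V 1, (0 : Fin 2)), HypCensus.cmPlace (L : Type) ι₁) *
            X (finProdFinEquiv (lineRow V 0, (1 : Fin 2)), HypCensus.cmPlace (L : Type) ι₁)) := by
  have hπ : (((Real.sqrt Real.pi : ℝ) : ℂ)) * (((Real.sqrt Real.pi : ℝ) : ℂ)) = ((Real.pi : ℝ) : ℂ) := by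
    rw [← Complex.ofReal_mul, Real.mul_self_sqrt Real.pi_pos.le]
  rw [wedgePoly, linePoly_eq, linePoly_eq, linePoly_eq, linePoly_eq]
  simp only [map_smul, map_mul, MvPolynomial.rename_X, slotIdx_inl, slotIdx_inr, slotCol_inl, slotCol_inr, Algebra.smul_mul_assoc,
    Algebra.mul_smul_comm, smul_smul, hπ, ← smul_sub]

/-- **the relabelling `conjColPerm S` fixes the variables at `v₁` when the bit is not set there.** -/
theorem rename_conjColPerm_X_of_not (hns : ¬ conjSwapAt S (placeUp (HypCensus.cmPlace (L : Type) ι₁))) (i : Fin 3) (j : Fin 2) :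
    rename (conjColPerm S) (X (finProdFinEquiv (i, j), HypCensus.cmPlace (L : Type) ι₁) :
        MvPolynomial (Fin (3 * 2) × {v : InfinitePlace (↥(maximalRealSubfield (L : Type))) // v.IsReal}) ℂ) =
      X (finProdFinEquiv (i, j), HypCensus.cmPlace (L : Type) ι₁) := by
  rw [MvPolynomial.rename_X, conjColPerm_apply, colPermAt_finProdFinEquiv, bitPerm_of_not S _ hns]

/-- **THE POLYNOMIAL IDENTITY `hpoly` AT THE BASE LETTER**: the `ι₁` determinant letter through binder-2's `jIAt` is `± π⁻¹` times the
relabelled wedge of carch-1's two line letters. -/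
theorem rename_jIAt_detZ_eq_smul_wedgePoly (hns : ¬ conjSwapAt S (placeUp (HypCensus.cmPlace (L : Type) ι₁))) :
    ∃ a'' : ℂ,
      rename (atPlace (HypCensus.cmPlace (L : Type) ι₁))
          (rename (jIAt (L : Type) (frameD V) (frameD_real V) (dW S) (dW_real S) ι₁ (frameD_sign_ι₁ V) hW) HodgeCM.PerL34.Fock.detZ) =
        a'' • rename (conjColPerm S) (wedgePoly V S hpos₂ hpos₃) := by
  -- the two numberings of `V⁺` differ by `τ ∈ {1, swap}`
  have hτ := perm_fin_two_eq ((iotaFrameA (L : Type) (frameD V) (frameD_real V) ι₁ (frameD_sign_ι₁ V)).trans (blockPosEquiv V))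
  have hrow := iotaRow_eq_lineRow V
  -- the determinant letter
  have hdet : rename (atPlace (HypCensus.cmPlace (L : Type) ι₁))
      (rename (jIAt (L : Type) (frameD V) (frameD_real V) (dW S) (dW_real S) ι₁ (frameD_sign_ι₁ V) hW) HodgeCM.PerL34.Fock.detZ) =
      X (finProdFinEquiv (iotaRow V 0, (0 : Fin 2)), HypCensus.cmPlace (L : Type) ι₁) *
          X (finProdFinEquiv (iotaRow V 1, (1 : Fin 2)), HypCensus.cmPlace (L : Type) ι₁) -
        X (finProdFinEquiv (iotaRow V 0, (1 : Fin 2)), HypCensus.cmPlace (L : Type) ι₁) *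
          X (finProdFinEquiv (iotaRow V 1, (0 : Fin 2)), HypCensus.cmPlace (L : Type) ι₁) := by
    simp only [HodgeCM.PerL34.Fock.detZ, HodgeCM.PerL34.Fock.z, map_sub, map_mul, MvPolynomial.rename_X, jIAt_inl]
  -- the relabelled wedge
  have hwedge : rename (conjColPerm S) (wedgePoly V S hpos₂ hpos₃) =
      ((Real.pi : ℝ) : ℂ) •
        (X (finProdFinEquiv (lineRow V 0, (0 : Fin 2)), HypCensus.cmPlace (L : Type) ι₁) *
            X (finProdFinEquiv (lineRow V 1, (1 : Fin 2)), HypCensus.cmPlace (L : Type) ι₁) -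
          X (finProdFinEquiv (lineRow V 1, (0 : Fin 2)), HypCensus.cmPlace (L : Type) ι₁) *
            X (finProdFinEquiv (lineRow V 0, (1 : Fin 2)), HypCensus.cmPlace (L : Type) ι₁)) := by
    rw [wedgePoly_eq, map_smul, map_sub, map_mul, map_mul, rename_conjColPerm_X_of_not S hns, rename_conjColPerm_X_of_not S hns,
      rename_conjColPerm_X_of_not S hns, rename_conjColPerm_X_of_not S hns]
  have hπ0 : ((Real.pi : ℝ) : ℂ) ≠ 0 := Complex.ofReal_ne_zero.2 Real.pi_pos.ne'
  rcases hτ with h1 | hs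
  · refine ⟨(((Real.pi : ℝ) : ℂ))⁻¹, ?_⟩
    rw [hdet, hwedge, smul_smul, inv_mul_cancel₀ hπ0, one_smul, hrow 0, hrow 1, h1, Equiv.Perm.coe_one, id_eq, id_eq]
    ring
  · refine ⟨-(((Real.pi : ℝ) : ℂ))⁻¹, ?_⟩
    rw [hdet, hwedge, smul_smul, neg_mul, inv_mul_cancel₀ hπ0, neg_one_smul, hrow 0, hrow 1, hs, Equiv.swap_apply_left, Equiv.swap_apply_right]
    ring

end Poly

end HodgeCM.Model

end
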